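import Mathlib.FieldTheory.Galois.Infinite
import Literature.AnabelianGeometry.AbsoluteAnabelian.AbsAnabFundamentalGroups
import Literature.AnabelianGeometry.AbsoluteAnabelian.FundamentalExtensionRestriction
import Literature.FieldTheory.Galois.FixingSubgroupAbsoluteGalois
import HarnessLib

/-!
# MLF base data for the restriction of `1 → Δ → Π → G → 1` to an open subgroup `U ⊆ Π`

abc-iut cell, layer L4, adapter «MLFBASE-OF-OPEN» (L4-lead 2026-08-26T11:49:03Z / 12:02:17Z; writer
abc-iut-L4-t11; consumers abc-iut-w6-d034 / w6-d073 / w6-d027 by name).  S. Mochizuki, *The Absolute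
Anabelian Geometry of Hyperbolic Curves* (2004) [AbsAnab], proof of Lemma 1.1.4 p. 7: "Denote by `K′`
the finite extension of `F_𝔭` determined by `G′`" — for an open subgroup `G′` of `G = G_K`; and
*Topics in Absolute Anabelian Geometry III* (2015) [AbsTopIII], Thm 1.9, final paragraph p. 38:
functoriality "with respect to arbitrary open injective homomorphisms of extensions of profinite
groups".  In the tree's vocabulary: given MLF base data `B : E.MLFBase` (`G ≅ G_K`, `K/ℚ_p` finite,
`AbsAnabFundamentalGroups.lean`) and an open subgroup `U ⊆ Π`, the restricted extension
`E.ofOpenSubgroup U = (1 → Δ ∩ U → U → aug(U) → 1)` (`FundamentalExtensionRestriction.lean`, A1)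
again carries MLF base data, CONSTRUCTED here:

* `MLFBase.galImage B U ≤ G_K` — the open image of `aug(U) ⊆ G` under `B.galIso`;
* `MLFBase.fixedFieldOfOpen B U = K_U := K̄^{galImage} ⊆ K̄` — "the finite extension of `K`
  determined by" `aug(U)` (Krull's Galois correspondence, Mathlib `InfiniteGalois`), with
  `Gal(K̄/K_U) = galImage` (`fixingSubgroup_fixedFieldOfOpen`), `K_U/K` finite of degree
  `[K_U : K] = [G : aug(U)]` (`finrank_fixedFieldOfOpen`) and
  `[K_U : ℚ_p] = [G : aug(U)]·[K : ℚ_p]` (`finrank_padic_fixedFieldOfOpen`);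
* `MLFBase.galIsoOfOpen B U : (E.ofOpenSubgroup U).gal ≃ₜ* G_{K_U}` — the composite
  `aug(U) ≅ galImage = Gal(K̄/K_U) ≅ Gal(K̄_Uᵃˡᵍ/K_U)` (the last step is the tree's
  `Literature.FieldTheory.Galois.fixingSubgroupEquivAbsoluteGaloisGroup`, canonical up to the inner
  automorphism coming from the choice of a `K_U`-isomorphism `K̄ ≅ K̄_Uᵃˡᵍ`), with
  `coe_galIsoRestrict_apply` recording that on underlying elements the first two steps ARE `B.galIso`;
* **`MLFBase.ofOpenSubgroup B U : (E.ofOpenSubgroup U).MLFBase`** — `p` unchanged (`ofOpenSubgroup_p`),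
  base field `K_U` (`ofOpenSubgroup_K`), `galIso = galIsoOfOpen`.

Pure Galois-theoretic plumbing (Krull topology; Neukirch, *Algebraic Number Theory*, Ch. IV §1); no
geometry is claimed; one `def` with body per item + theorems, no `instance` beyond the `MLFBase`
structure's own attribute pattern, no notation.  Nothing here bears on the disputed [IUTchIII]
Cor. 3.12; typed ≠ proved elsewhere.  Deliberately NOT here: the descent of `Δ` tfg / pro-`Σ` to
`Δ ∩ U` (proof-only companion `FundamentalExtensionRestrictionMLFBaseDescent.lean`), and the
comparison with the restriction map `absGaloisRestrict K K_U : G_{K_U} → G_K` of the trunk (which is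
defined through an independent choice of embedding and agrees with the inclusion `aug(U) ↪ G` only up
to `G_K`-conjugacy).
-/

noncomputable section

open Topology

universe u

namespace Literature.AnabelianGeometry.AbsoluteAnabelian

open Field

namespace FundamentalExtension

namespace MLFBase

variable {E : FundamentalExtension.{u}} (B : E.MLFBase) (U : OpenSubgroup E.arith)

/-! ### The open subgroup of `G_K` determined by `U` -/

/-- The image `galImage B U ≤ G_K` of `aug(U) ⊆ G` under the identification `B.galIso : G ≅ G_K`
("`G′ ⊆ G_K`" of [AbsAnab] Lemma 1.1.4 proof p. 7). [cite: MochizukiAbsAnab2004, Lemma 1.1.4 proof p.7] -/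
def galImage : Subgroup (absoluteGaloisGroup B.K) :=
  (E.augImage U).toSubgroup.map (B.galIso : E.gal →* absoluteGaloisGroup B.K)

/-- Membership in `galImage`: `γ ∈ galImage ↔ galIso⁻¹ γ ∈ aug(U)`.
[cite: MochizukiAbsAnab2004, Lemma 1.1.4 proof p.7] -/
theorem mem_galImage_iff {γ : absoluteGaloisGroup B.K} :
    γ ∈ B.galImage U ↔ B.galIso.symm γ ∈ (E.augImage U).toSubgroup := by
  constructor
  · rintro ⟨g, hg, rfl⟩
    change B.galIso.symm (B.galIso g) ∈ _
    rwa [ContinuousMulEquiv.symm_apply_apply]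
  · intro h
    exact ⟨B.galIso.symm γ, h, B.galIso.apply_symm_apply γ⟩

/-- `galIso g ∈ galImage ↔ g ∈ aug(U)`. [cite: MochizukiAbsAnab2004, Lemma 1.1.4 proof p.7] -/
theorem galIso_mem_galImage_iff {g : E.gal} : B.galIso g ∈ B.galImage U ↔ g ∈ (E.augImage U).toSubgroup := by
  rw [mem_galImage_iff, ContinuousMulEquiv.symm_apply_apply]

/-- `galImage` is open in `G_K` (image of the open subgroup `aug(U)` under a homeomorphism).
[cite: MochizukiAbsAnab2004, Lemma 1.1.4 proof p.7] -/
theorem isOpen_galImage : IsOpen (B.galImage U : Set (absoluteGaloisGroup B.K)) := by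
  have h : (B.galImage U : Set (absoluteGaloisGroup B.K)) = B.galIso '' ((E.augImage U).toSubgroup : Set E.gal) :=
    Subgroup.coe_map _ _
  rw [h]
  exact B.galIso.toHomeomorph.isOpenMap _ (E.isOpen_augImage U)

/-- `galImage` is closed in `G_K`. [cite: MochizukiAbsAnab2004, Lemma 1.1.4 proof p.7] -/
theorem isClosed_galImage : IsClosed (B.galImage U : Set (absoluteGaloisGroup B.K)) :=
  (B.galImage U).isClosed_of_isOpen (B.isOpen_galImage U)

/-- `[G_K : galImage] = [G : aug(U)]`. [cite: MochizukiAbsAnab2004, Lemma 1.1.4 proof p.7] -/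
theorem index_galImage : (B.galImage U).index = (E.augImage U).toSubgroup.index :=
  Subgroup.index_map_equiv (E.augImage U).toSubgroup B.galIso.toMulEquiv

/-- `galImage` as a closed subgroup of `Gal(K̄/K)` (Mathlib's carrier of the Krull topology).
[cite: MochizukiAbsAnab2004, Lemma 1.1.4 proof p.7] -/
def galImageClosed : ClosedSubgroup (AlgebraicClosure B.K ≃ₐ[B.K] AlgebraicClosure B.K) :=
  ⟨B.galImage U, B.isClosed_galImage U⟩

/-! ### The finite extension `K_U` of `K` determined by `U` -/

/-- **`K_U := K̄^{galImage}`**, "the finite extension of `K` determined by" the open subgroup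
`aug(U) ⊆ G ≅ G_K` (its fixed field in the algebraic closure `K̄`).
[cite: MochizukiAbsAnab2004, Lemma 1.1.4 proof p.7] -/
def fixedFieldOfOpen : IntermediateField B.K (AlgebraicClosure B.K) :=
  IntermediateField.fixedField (B.galImageClosed U).toSubgroup

/-- `K` has characteristic zero (it is a `ℚ_p`-algebra). [cite: MochizukiAbsAnab2004, §1.1 p.7] -/
theorem charZero_K : CharZero B.K :=
  charZero_of_injective_algebraMap (algebraMap ℚ_[B.p] B.K).injective

/-- Krull's correspondence: `Gal(K̄/K_U) = galImage`. [cite: NeukirchANT1999, Ch. IV §1] -/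
theorem fixingSubgroup_fixedFieldOfOpen :
    (B.fixedFieldOfOpen U).fixingSubgroup = (B.galImageClosed U).toSubgroup := by
  haveI := B.charZero_K
  exact InfiniteGalois.fixingSubgroup_fixedField (B.galImageClosed U)

/-- `K_U / K` is a finite extension (its fixing subgroup is open). [cite: NeukirchANT1999, Ch. IV §1] -/
theorem finiteDimensional_fixedFieldOfOpen : FiniteDimensional B.K (B.fixedFieldOfOpen U) := by
  haveI := B.charZero_K
  rw [← InfiniteGalois.isOpen_iff_finite, fixingSubgroup_fixedFieldOfOpen]
  exact B.isOpen_galImage U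

/-- **`[K_U : K] = [G : aug(U)]`** (Krull: the degree of the fixed field is the index of the open
subgroup — "a factor given by the index of the open subgroups of `G_k` under consideration",
[AbsTopIII] Rmk 1.10.1 (iii) p. 44). [cite: MochizukiAbsTopIII2015, Remark 1.10.1 (iii) p.44] -/
theorem finrank_fixedFieldOfOpen :
    Module.finrank B.K (B.fixedFieldOfOpen U) = (E.augImage U).toSubgroup.index := by
  haveI := B.charZero_K
  rw [IntermediateField.finrank_eq_fixingSubgroup_index, fixingSubgroup_fixedFieldOfOpen, ← B.index_galImage U]
  rfl

/-- `K_U / ℚ_p` is finite. [cite: MochizukiAbsAnab2004, Lemma 1.1.4 proof p.7] -/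
theorem finiteDimensional_padic_fixedFieldOfOpen : FiniteDimensional ℚ_[B.p] (B.fixedFieldOfOpen U) := by
  haveI := B.finiteDimensional_fixedFieldOfOpen U
  exact Module.Finite.trans B.K (B.fixedFieldOfOpen U)

/-- **`[K_U : ℚ_p] = [G : aug(U)] · [K : ℚ_p]`** ([AbsAnab] Lemma 1.1.4 proof p. 7:
"`[G : G′] · [F_𝔭 : ℚ_p] = [K′ : ℚ_p]`"). [cite: MochizukiAbsAnab2004, Lemma 1.1.4 proof p.7] -/
theorem finrank_padic_fixedFieldOfOpen :
    Module.finrank ℚ_[B.p] (B.fixedFieldOfOpen U) =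
      (E.augImage U).toSubgroup.index * Module.finrank ℚ_[B.p] B.K := by
  rw [← Module.finrank_mul_finrank ℚ_[B.p] B.K (B.fixedFieldOfOpen U), finrank_fixedFieldOfOpen, mul_comm]

/-! ### `aug(U) ≅ G_{K_U}` -/

/-- `aug(U) ≅ galImage` — the restriction of `B.galIso` to `aug(U)` and its image.
[cite: MochizukiAbsAnab2004, Lemma 1.1.4 proof p.7] -/
def galIsoRestrict : (E.ofOpenSubgroup U).gal ≃ₜ* (B.galImageClosed U).toSubgroup where
  toFun g := ⟨B.galIso g.1, g.1, g.2, rfl⟩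
  invFun γ := ⟨B.galIso.symm γ.1, (B.mem_galImage_iff U).1 γ.2⟩
  left_inv g := Subtype.ext (B.galIso.symm_apply_apply g.1)
  right_inv γ := Subtype.ext (B.galIso.apply_symm_apply γ.1)
  map_mul' g h := Subtype.ext (map_mul B.galIso g.1 h.1)
  continuous_toFun := (B.galIso.continuous.comp continuous_subtype_val).subtype_mk _
  continuous_invFun := (B.galIso.symm.continuous.comp continuous_subtype_val).subtype_mk _

/-- On underlying elements `galIsoRestrict` IS `B.galIso`. [cite: MochizukiAbsAnab2004, Lemma 1.1.4 proof p.7] -/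
@[simp] theorem coe_galIsoRestrict_apply (g : (E.ofOpenSubgroup U).gal) :
    (B.galIsoRestrict U g).1 = B.galIso g.1 := rfl

/-- On underlying elements `galIsoRestrict.symm` IS `B.galIso.symm`. [cite: MochizukiAbsAnab2004, Lemma 1.1.4 proof p.7] -/
@[simp] theorem coe_galIsoRestrict_symm_apply (γ : (B.galImageClosed U).toSubgroup) :
    ((B.galIsoRestrict U).symm γ).1 = B.galIso.symm γ.1 := rfl

/-- `galImage ≅ Gal(K̄/K_U)` — the identity on underlying elements (the two subgroups coincide,
`fixingSubgroup_fixedFieldOfOpen`). [cite: NeukirchANT1999, Ch. IV §1] -/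
def galImageEquivFixingSubgroup :
    (B.galImageClosed U).toSubgroup ≃ₜ* (B.fixedFieldOfOpen U).fixingSubgroup :=
  { MulEquiv.subgroupCongr (B.fixingSubgroup_fixedFieldOfOpen U).symm with
    continuous_toFun := continuous_induced_rng.2 continuous_subtype_val
    continuous_invFun := continuous_induced_rng.2 continuous_subtype_val }

/-- `galImageEquivFixingSubgroup` is the identity on underlying elements. [cite: NeukirchANT1999, Ch. IV §1] -/
@[simp] theorem coe_galImageEquivFixingSubgroup_apply (γ : (B.galImageClosed U).toSubgroup) :
    (B.galImageEquivFixingSubgroup U γ).1 = γ.1 := rfl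

/-- **`aug(U) ≅ G_{K_U}`**: the composite `aug(U) ≅ galImage = Gal(K̄/K_U) ≅ Gal(K̄_Uᵃˡᵍ/K_U)`
("`G′ = G_{K′}`", [AbsAnab] Lemma 1.1.4 proof p. 7), the last step being the tree's
`fixingSubgroupEquivAbsoluteGaloisGroup K_U`. [cite: MochizukiAbsAnab2004, Lemma 1.1.4 proof p.7] -/
def galIsoOfOpen : (E.ofOpenSubgroup U).gal ≃ₜ* absoluteGaloisGroup (B.fixedFieldOfOpen U) :=
  (B.galIsoRestrict U).trans ((B.galImageEquivFixingSubgroup U).trans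
    (Literature.FieldTheory.Galois.fixingSubgroupEquivAbsoluteGaloisGroup (B.fixedFieldOfOpen U)))

/-- Unfolding `galIsoOfOpen`: it is `fixingSubgroupEquivAbsoluteGaloisGroup K_U` applied to
`B.galIso g ∈ Gal(K̄/K_U)`. [cite: MochizukiAbsAnab2004, Lemma 1.1.4 proof p.7] -/
theorem galIsoOfOpen_apply (g : (E.ofOpenSubgroup U).gal) :
    B.galIsoOfOpen U g =
      Literature.FieldTheory.Galois.fixingSubgroupEquivAbsoluteGaloisGroup (B.fixedFieldOfOpen U)
        (B.galImageEquivFixingSubgroup U (B.galIsoRestrict U g)) := rfl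

/-! ### The MLF base data of `E.ofOpenSubgroup U` -/

/-- **MLF base data for the restricted extension** `E.ofOpenSubgroup U = (1 → Δ ∩ U → U → aug(U) → 1)`:
same prime `p`, base field `K_U = K̄^{aug(U)}` (finite over `ℚ_p`), and `aug(U) ≅ G_{K_U}`
("Denote by `K′` the finite extension of `F_𝔭` determined by `G′`", [AbsAnab] Lemma 1.1.4 proof
p. 7; functoriality of [AbsTopIII] Thm 1.9 in open injective homomorphisms, p. 38).
[cite: MochizukiAbsAnab2004, Lemma 1.1.4 proof p.7] -/
def ofOpenSubgroup : (E.ofOpenSubgroup U).MLFBase :=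
  haveI := B.finiteDimensional_padic_fixedFieldOfOpen U
  { p := B.p
    K := B.fixedFieldOfOpen U
    galIso := B.galIsoOfOpen U }

/-- The residue characteristic is unchanged. [cite: MochizukiAbsAnab2004, Lemma 1.1.4 proof p.7] -/
@[simp] theorem ofOpenSubgroup_p : (B.ofOpenSubgroup U).p = B.p := rfl

/-- The base field of the restricted data is `K_U`. [cite: MochizukiAbsAnab2004, Lemma 1.1.4 proof p.7] -/
theorem ofOpenSubgroup_K : (B.ofOpenSubgroup U).K = ↥(B.fixedFieldOfOpen U) := rfl

/-- The Galois identification of the restricted data is `galIsoOfOpen`.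
[cite: MochizukiAbsAnab2004, Lemma 1.1.4 proof p.7] -/
theorem ofOpenSubgroup_galIso : (B.ofOpenSubgroup U).galIso = B.galIsoOfOpen U := rfl

/-- **`[K_U : ℚ_p] = [G : aug(U)] · [K : ℚ_p]`** for the base field of `B.ofOpenSubgroup U`.
[cite: MochizukiAbsAnab2004, Lemma 1.1.4 proof p.7] -/
theorem finrank_ofOpenSubgroup_K :
    Module.finrank ℚ_[(B.ofOpenSubgroup U).p] (B.ofOpenSubgroup U).K =
      (E.augImage U).toSubgroup.index * Module.finrank ℚ_[B.p] B.K :=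
  B.finrank_padic_fixedFieldOfOpen U

end MLFBase

/-- An extension with MLF base data restricts, along any open `U ⊆ Π`, to an extension with MLF base
data (existence form for consumers quantifying over `Nonempty E.MLFBase`).
[cite: MochizukiAbsAnab2004, Lemma 1.1.4 proof p.7] -/
theorem nonempty_mlfBase_ofOpenSubgroup {E : FundamentalExtension.{u}} (h : Nonempty E.MLFBase)
    (U : OpenSubgroup E.arith) : Nonempty (E.ofOpenSubgroup U).MLFBase :=
  ⟨h.some.ofOpenSubgroup U⟩

end FundamentalExtension

end Literature.AnabelianGeometry.AbsoluteAnabelian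

end
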